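import Summits.BirchSwinnertonDyer.Rank2.MatsunoBridgeAtTwoDichotomy
import Literature.NumberTheory.EllipticCurves.IwasawaAlgebraSpecializationIndexProofs
import HarnessLib

/-!
# The finite-layer `μ`-certificate: `μ(X) = 0` from ONE finite quotient `X/(p, T^m)X`, and the
# Matsuno-bridge DICHOTOMY at `2` with its only non-print input `μ(X₂(E₀/ℚ_∞)) = 0` CERTIFIED

Planner p2 GEN 47 kernel (cell bsd-rank2, HOME `run/shared/lean/pub/bsd-rank2/`, file
`HOME/p2/g47/lean/MuCertificateAtTwo.lean`; memo `HOME/p2/g47/TIGHT-ANCHOR.md`).  Sequel of the GEN 43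
kernel `MatsunoBridgeAtTwo{Pinch,Bridge,Dichotomy}` (tree).  That kernel proves, on the whole Matsuno door
class of a rank-`2` base curve `E₀` (good ordinary at `2`, `E₀[2]` irreducible), the `2`-adic dichotomy
`corank_{ℤ₂} Sel_{2^∞}(A/ℚ) = ord_{T=0} L₂(A,T) ∈ {0, 2}` — modulo PRINT facts and exactly ONE non-print
input, the vanishing `μ(X₂(E₀/ℚ_∞)) = 0` of the algebraic `μ`-invariant of the base (GEN 43, §7, offered it
from Kato's Thm. 17.4 (3) at `p = 2`, which is not in print).  THIS file replaces that input by a FINITE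
CERTIFICATE:

* §1 (pure algebra, any prime `p`, any finitely generated torsion `Λ = ℤ_p⟦T⟧`-module `M`):
  `μ(M) ≠ 0 ⟹ #(M/(p, T^m)M) ≥ #(Λ/(p, T^m)) (= p^m)` for every `m`; contrapositively
  `#(M/(p,T^m)M) < #(Λ/(p,T^m)) ⟹ μ(M) = 0` (`muInvariant_eq_zero_of_natCard_quotient_lt`).  Proof: by the
  structure theorem `M → E = ⨁ Λ/(p^{μ_i}) ⊕ ⨁ Λ/(f_j^{n_j})` has finite cokernel; if some `μ_i ≥ 1`, compose
  with `E ↠ Λ/(p^{μ_i}) ↠ Λ/(p) =: Q`: the image `I ⊆ Q` of `M` has finite index, and an index count in the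
  domain `Q` (multiplication by `T^m` is injective and carries `I` onto `T^m I`) gives
  `#(I/T^m I) = #(Q/T^m Q) = #(Λ/(p,T^m))`, while `M/(p,T^m)M ↠ I/T^m I`.  Also the count
  `#(Λ/(p,T^m)) = p^m` (`natCard_quotient_span_C_X_pow`, coefficient map onto `𝔽_p^m`), the form
  `#(M/(p,T^m)M) < p^m ⟹ μ(M) = 0` (`muInvariant_eq_zero_of_natCard_quotient_lt_pow`), and the LAYER
  DICTIONARY `(p, T^{p^n}) = (p, ω_n)`, `ω_n = (1+T)^{p^n} − 1` (`span_C_X_pow_eq_span_C_omega`, Frobenius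
  mod `p`), so that the certificate quotient at `m = p^n` is `(M/pM)_{Γ_n}`.
* §2: the same for a Selmer dual datum `D` (`X = D.X = X_p(E/ℚ_∞)`): `#(X/(p,T^m)X) < p^m ⟹ μ = 0`, and at
  layer `n`: `#(X/(p, ω_n)X) < p^{p^n} ⟹ μ = 0` (`SelmerDualData.mu_eq_zero_of_natCard_layerQuotient_lt`).
* §3: GEN 43's dichotomy `twoAdicBSD_corank_dichotomy_of_matsunoBridge_door` / `…_primeDoor` with the
  hypothesis `hμ₀ : D₀.mu = 0` REPLACED by the certificate inequality for `X₂(E₀/ℚ_∞)` at one layer `m`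
  (`twoAdicBSD_corank_dichotomy_of_muCert`, `…_primeDoor_of_muCert`).

How the certificate is evaluated (memo TIGHT-ANCHOR.md, Lemma CERT-μ; not formalised here): with
`m = 2^n`, `(p, T^{2^n}) = (p, ω_n)` and `X/(2,ω_n)X = ((Sel_{2^∞}(E₀/ℚ_∞)[2])^{Γ_n})^∨` embeds in a relaxed
`2`-Selmer group of `E₀` over the layer `ℚ_n = ℚ(ζ_{2^{n+2}})⁺`, whose `𝔽₂`-dimension is bounded by a
`2`-descent over `ℚ_n` plus explicit local terms (Greenberg–Wiles): criterion
`dim Sel₂(E₀/ℚ_n) + σ_𝔭 + σ_N ≤ 2^n − 1`.  The memo records why layer `n = 2` cannot fire for the χ₈-floor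
door class (`Δ ≡ ±3 (8)` forces a Kodaira III/III* prime or `N ≡ 3 (8)`) and that `n = 3`
(`ℚ(ζ₃₂)⁺`, `Δ = ±□`, `σ_𝔭 = 2`, `σ_N = 0`, `dim Sel₂(E₀/ℚ(ζ₃₂)⁺) ≤ 5`) is the first live layer.  B1 HONESTY: nothing here mentions the analytic rank; `ord_T L₂` is
the `2`-adic order; BSD is not proved; the certificate is a hypothesis of §3, discharged outside Lean.

## References
* L. C. Washington, *Introduction to Cyclotomic Fields*, GTM 83, §13.2 (Thm. 13.12, Lemma 13.7). [Washington1997]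
* R. Greenberg, LNM 1716 (1999), §1 (Conj. 1.11), Thm. 1.10. [GreenbergLNM1716]
* K. Matsuno, Int. J. Number Theory 4 (2008) 403–422, Thm. 5.1. [Matsuno2008]
* K. Kato, Astérisque 295 (2004), Thm. 17.4 (1)(2). [Kato2004Asterisque]
-/

-- LANDING NOTE (star-p1 GEN 21, 2026-08-29): p2 GEN 47's kernel `HOME/p2/g47/lean/MuCertificateAtTwo.lean` (sha16 a426cb715bfd998f, 502 lines)
-- split for the 400-line rule: THIS FILE = §1 (the μ-criterion algebra); `Rank2/MuCertificateAtTwo.lean` = §2–§3.  Text otherwise verbatim.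


set_option autoImplicit false

noncomputable section

open scoped Classical MatrixGroups ModularForm DirectSum

open CongruenceSubgroup WeierstrassCurve Literature.NumberTheory.EllipticCurves
  Literature.NumberTheory.EllipticCurves.ModularForms
  Literature.NumberTheory.EllipticCurves.IwasawaAlgebra
  Literature.NumberTheory.EllipticCurves.Rank1Residual
  Literature.NumberTheory.EllipticCurves.Rank1Residual.Typed
  Literature.NumberTheory.EllipticCurves.Greenberg1999
  Summit.BirchSwinnertonDyer.BirchSwinnertonDyer.Theorems.Rank1ResidualX1Defs
  Summit.BirchSwinnertonDyer.Rank1Residual.X1.MuLambda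
  Summit.BirchSwinnertonDyer.Rank1Residual.X1.MuPart
  Summit.BirchSwinnertonDyer.Rank1Residual.X1.ParitySqueeze
  Summit.BirchSwinnertonDyer.Rank1Residual.X1.RankOneParitySqueeze
  Summit.BirchSwinnertonDyer.Rank1Residual.X5
  Summit.BirchSwinnertonDyer.Rank1Residual.X5.O1

namespace Summit.BirchSwinnertonDyer.Rank2

/-! ### §1. Algebra: `μ(M) ≠ 0 ⟹ #(M/(p,T^m)M) ≥ #(Λ/(p,T^m))` -/

section MuCriterion

/-- **Index count in a module along an injective endomorphism.** `θ : Q → Q` injective `R`-linear,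
`I ≤ Q` a submodule of finite index with `θ(I) ≤ I`; then `#(I/θ I) = #(Q/θ Q)`, where `I/θ I` is realised
as the image of `I` in `Q/θ I`.  (Two ways of counting `#(Q/θ I)`: through `I` and through `θ Q ≅ Q ⊇ θ I ≅ I`.)
[cite: Washington1997, §13.2 (index computations with Λ-modules, Lemma 13.7)] -/
theorem natCard_map_mkQ_eq_of_injective {R : Type*} [CommRing R] {Q : Type*} [AddCommGroup Q]
    [Module R Q] (θ : Q →ₗ[R] Q) (hθ : Function.Injective θ) (I : Submodule R Q)
    (hθI : I.map θ ≤ I) [Finite (Q ⧸ I)] :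
    Nat.card (I.map (I.map θ).mkQ) = Nat.card (Q ⧸ LinearMap.range θ) := by
  have hAC : I.map θ ≤ LinearMap.range θ := LinearMap.map_le_range
  -- (α) `#(Q/θI) = #(image of I) · #(Q/I)`
  have h1 := Submodule.card_eq_card_quotient_mul_card (I.map (I.map θ).mkQ)
  rw [Nat.card_congr (Submodule.quotientQuotientEquivQuotient (I.map θ) I hθI).toEquiv] at h1
  -- (β) `#(Q/θI) = #(image of θQ) · #(Q/θQ)`
  have h2 := Submodule.card_eq_card_quotient_mul_card ((LinearMap.range θ).map (I.map θ).mkQ)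
  rw [Nat.card_congr
    (Submodule.quotientQuotientEquivQuotient (I.map θ) (LinearMap.range θ) hAC).toEquiv] at h2
  -- (γ) the image of `θQ` in `Q/θI` is `≅ Q/I` (first isomorphism theorem for `q ↦ θ q mod θI`)
  have hker : LinearMap.ker ((I.map θ).mkQ ∘ₗ θ) = I := by
    rw [LinearMap.ker_comp, Submodule.ker_mkQ]; exact Submodule.comap_map_eq_of_injective hθ I
  have hrange : LinearMap.range ((I.map θ).mkQ ∘ₗ θ) = (LinearMap.range θ).map (I.map θ).mkQ :=
    LinearMap.range_comp θ (I.map θ).mkQ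
  have e3 : (Q ⧸ I) ≃ₗ[R] ((LinearMap.range θ).map (I.map θ).mkQ : Submodule R (Q ⧸ I.map θ)) :=
    (Submodule.quotEquivOfEq _ _ hker.symm).trans
      ((LinearMap.quotKerEquivRange _).trans (LinearEquiv.ofEq _ _ hrange))
  have h3 : Nat.card ((LinearMap.range θ).map (I.map θ).mkQ : Submodule R (Q ⧸ I.map θ)) =
      Nat.card (Q ⧸ I) := (Nat.card_congr e3.toEquiv).symm
  have hn : 0 < Nat.card (Q ⧸ I) := Nat.card_pos
  have h := h1.symm.trans h2
  rw [h3, mul_comm (Nat.card (Q ⧸ I))] at h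
  exact Nat.eq_of_mul_eq_mul_right hn h

variable (p : ℕ) [Fact p.Prime]

/-- **The finite-layer `μ`-criterion** (structure theory of `Λ = ℤ_p⟦T⟧`-modules).  `M` a finitely
generated torsion `Λ`-module, `m : ℕ`; if the finite quotient `M/(p, T^m)M` has FEWER elements than
`Λ/(p, T^m)` (`= p^m`), then `μ(M) = 0`.  Equivalently `μ(M) ≥ 1 ⟹ #(M/(p,T^m)M) ≥ p^m`: a summand
`Λ/(p^{μ₁})`, `μ₁ ≥ 1`, of the elementary module maps onto `Q = Λ/(p) ≅ 𝔽_p⟦T⟧`, the image `I` of `M` in `Q`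
has finite index, `M/(p,T^m)M ↠ I/T^m I`, and `#(I/T^m I) = #(Q/T^m Q) = #(Λ/(p,T^m))`
(`natCard_map_mkQ_eq_of_injective`, multiplication by `T^m` being injective on the domain `Q`).  With
`m = p^n`, `(p, T^{p^n}) = (p, ω_n)`: the input is ONE finite quotient at ONE layer of the tower.
[cite: Washington1997, §13.2, Thm. 13.12 (structure theorem) and Lemma 13.7]
[cite: GreenbergLNM1716, §1, Thm. 1.10 and Conj. 1.11 (`μ = 0`)] -/
theorem muInvariant_eq_zero_of_natCard_quotient_lt {M : Type*} [AddCommGroup M]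
    [Module (IwasawaAlgebra p) M] [Module.Finite (IwasawaAlgebra p) M]
    (hM : Module.IsTorsion (IwasawaAlgebra p) M) (m : ℕ)
    [Finite (M ⧸ (Ideal.span {PowerSeries.C (p : ℤ_[p]), (PowerSeries.X : IwasawaAlgebra p) ^ m} •
      (⊤ : Submodule (IwasawaAlgebra p) M)))]
    (hlt : Nat.card (M ⧸ (Ideal.span {PowerSeries.C (p : ℤ_[p]), (PowerSeries.X : IwasawaAlgebra p) ^ m} •
        (⊤ : Submodule (IwasawaAlgebra p) M))) <
      Nat.card (IwasawaAlgebra p ⧸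
        Ideal.span {PowerSeries.C (p : ℤ_[p]), (PowerSeries.X : IwasawaAlgebra p) ^ m})) :
    muInvariant p M = 0 := by
  classical
  set 𝔞 : Ideal (IwasawaAlgebra p) :=
    Ideal.span {PowerSeries.C (p : ℤ_[p]), (PowerSeries.X : IwasawaAlgebra p) ^ m} with h𝔞
  by_contra hμ
  -- Step 1: structure theorem; a `μ`-summand `Λ/(p^{μ₁})`, `μ₁ ≥ 1`
  obtain ⟨μs, fs, hμs, hfs, φ, hφ⟩ := exists_isPseudoIsomorphism_elementary_holds p M hM
  have hsum : muInvariant p M = μs.sum :=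
    muInvariant_eq_sum_holds p M (fun f hf => (hfs f hf).1) ⟨φ, hφ⟩
  have hne : μs ≠ [] := by
    intro h; apply hμ; rw [hsum, h, List.sum_nil]
  have hlen : 0 < μs.length := List.length_pos_iff.mpr hne
  set i : Fin μs.length := ⟨0, hlen⟩ with hi
  have hμi : 0 < μs.get i := hμs _ (List.get_mem μs i)
  -- Step 2: the projection `ρ : E ↠ Q = Λ/(p)`
  have hle : Ideal.span {PowerSeries.C ((p : ℤ_[p]) ^ μs.get i)} ≤ augIdealP p := by
    rw [augIdealP, Ideal.span_singleton_le_span_singleton, map_pow]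
    exact dvd_pow_self _ hμi.ne'
  let e : elementaryModule p μs fs ≃ₗ[IwasawaAlgebra p]
      ((⨁ k : Fin μs.length,
          IwasawaAlgebra p ⧸ Ideal.span {PowerSeries.C ((p : ℤ_[p]) ^ μs.get k)}) ×
        ⨁ j : Fin fs.length,
          IwasawaAlgebra p ⧸ Ideal.span {((fs.get j).1 : IwasawaAlgebra p) ^ (fs.get j).2}) :=
    LinearEquiv.refl _ _
  let ρ : elementaryModule p μs fs →ₗ[IwasawaAlgebra p] IwasawaAlgebra p ⧸ augIdealP p :=
    (Submodule.factor hle) ∘ₗ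
      (DirectSum.component (IwasawaAlgebra p) (Fin μs.length)
        (fun k => IwasawaAlgebra p ⧸ Ideal.span {PowerSeries.C ((p : ℤ_[p]) ^ μs.get k)}) i) ∘ₗ
      (LinearMap.fst (IwasawaAlgebra p) _ _) ∘ₗ e.toLinearMap
  have hρ : Function.Surjective ρ := by
    intro q
    obtain ⟨s, rfl⟩ := Submodule.mkQ_surjective (augIdealP p) q
    refine ⟨e.symm (DirectSum.lof (IwasawaAlgebra p) (Fin μs.length)
      (fun k => IwasawaAlgebra p ⧸ Ideal.span {PowerSeries.C ((p : ℤ_[p]) ^ μs.get k)}) i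
      (Submodule.Quotient.mk s), 0), ?_⟩
    simp only [ρ, LinearMap.comp_apply, LinearEquiv.coe_toLinearMap, LinearEquiv.apply_symm_apply,
      LinearMap.fst_apply, DirectSum.component.lof_self]
    rfl
  -- Step 3: `ψ : M → Q`, its image `I`, and `Q/I` finite
  let ψ : M →ₗ[IwasawaAlgebra p] IwasawaAlgebra p ⧸ augIdealP p := ρ ∘ₗ φ
  let I : Submodule (IwasawaAlgebra p) (IwasawaAlgebra p ⧸ augIdealP p) := LinearMap.range ψ
  haveI : Module.Finite (IwasawaAlgebra p) (elementaryModule p μs fs) :=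
    IwasawaAlgebra.moduleFinite_elementaryModule p μs fs
  have hEfin : Finite (elementaryModule p μs fs ⧸ LinearMap.range φ) :=
    (isPseudoNull_iff_finite_holds p (elementaryModule p μs fs ⧸ LinearMap.range φ)).mp hφ.2
  haveI hQI : Finite ((IwasawaAlgebra p ⧸ augIdealP p) ⧸ I) := by
    have hle' : LinearMap.range φ ≤ I.comap ρ := by
      rintro _ ⟨x, rfl⟩; exact ⟨x, rfl⟩
    refine Finite.of_surjective (Submodule.mapQ (LinearMap.range φ) I ρ hle') ?_
    intro z
    obtain ⟨q, rfl⟩ := Submodule.mkQ_surjective I z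
    obtain ⟨x, rfl⟩ := hρ q
    exact ⟨(LinearMap.range φ).mkQ x, rfl⟩
  -- Step 4: `θ = T^m ·` on the domain `Q` is injective
  haveI : (augIdealP p).IsPrime := isPrime_augIdealP_holds p
  let θ : (IwasawaAlgebra p ⧸ augIdealP p) →ₗ[IwasawaAlgebra p] (IwasawaAlgebra p ⧸ augIdealP p) :=
    LinearMap.lsmul (IwasawaAlgebra p) _ ((PowerSeries.X : IwasawaAlgebra p) ^ m)
  have hXm : Ideal.Quotient.mk (augIdealP p) ((PowerSeries.X : IwasawaAlgebra p) ^ m) ≠ 0 := by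
    rw [Ne, Ideal.Quotient.eq_zero_iff_mem, augIdealP, Ideal.mem_span_singleton]
    intro hdvd
    obtain ⟨q, hq⟩ := (prime_C p).dvd_of_dvd_pow hdvd
    have h1 := congrArg (PowerSeries.coeff 1) hq
    rw [PowerSeries.coeff_one_X, PowerSeries.coeff_C_mul] at h1
    exact PadicInt.irreducible_p.not_isUnit (IsUnit.of_mul_eq_one _ h1.symm)
  have hθ : Function.Injective θ := by
    intro a b hab
    obtain ⟨s, rfl⟩ := Ideal.Quotient.mk_surjective a
    obtain ⟨t, rfl⟩ := Ideal.Quotient.mk_surjective b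
    have h' : Ideal.Quotient.mk (augIdealP p) ((PowerSeries.X : IwasawaAlgebra p) ^ m * s) =
        Ideal.Quotient.mk (augIdealP p) ((PowerSeries.X : IwasawaAlgebra p) ^ m * t) := hab
    rw [map_mul, map_mul] at h'
    exact mul_left_cancel₀ hXm h'
  have hAI : I.map θ ≤ I := by
    rintro _ ⟨y, hy, rfl⟩; exact I.smul_mem _ hy
  -- Step 5: `#(I/T^m I) = #(Q/T^m Q)` (index count) `= #(Λ/(p,T^m))`
  have hcount := natCard_map_mkQ_eq_of_injective θ hθ I hAI
  have hQC : Nat.card ((IwasawaAlgebra p ⧸ augIdealP p) ⧸ LinearMap.range θ) =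
      Nat.card (IwasawaAlgebra p ⧸ 𝔞) := by
    let π : IwasawaAlgebra p →ₗ[IwasawaAlgebra p]
        (IwasawaAlgebra p ⧸ augIdealP p) ⧸ LinearMap.range θ :=
      (LinearMap.range θ).mkQ ∘ₗ (augIdealP p).mkQ
    have hπ : Function.Surjective π :=
      (Submodule.mkQ_surjective _).comp (Submodule.mkQ_surjective _)
    have hkerπ : LinearMap.ker π = 𝔞 := by
      ext r
      simp only [π, LinearMap.mem_ker, LinearMap.comp_apply, Submodule.mkQ_apply,
        Submodule.Quotient.mk_eq_zero, LinearMap.mem_range]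
      constructor
      · rintro ⟨y, hy⟩
        obtain ⟨s, rfl⟩ := Submodule.mkQ_surjective (augIdealP p) y
        have h' : (Submodule.Quotient.mk ((PowerSeries.X : IwasawaAlgebra p) ^ m * s) :
            IwasawaAlgebra p ⧸ augIdealP p) = Submodule.Quotient.mk r := hy
        rw [Submodule.Quotient.eq, augIdealP, Ideal.mem_span_singleton'] at h'
        obtain ⟨a, ha⟩ := h'
        rw [h𝔞, Ideal.mem_span_pair]
        exact ⟨-a, s, by linear_combination -ha⟩
      · intro hr
        rw [h𝔞, Ideal.mem_span_pair] at hr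
        obtain ⟨a, b, hab⟩ := hr
        refine ⟨Submodule.Quotient.mk b, ?_⟩
        show (Submodule.Quotient.mk ((PowerSeries.X : IwasawaAlgebra p) ^ m * b) :
            IwasawaAlgebra p ⧸ augIdealP p) = Submodule.Quotient.mk r
        rw [Submodule.Quotient.eq, augIdealP, Ideal.mem_span_singleton']
        exact ⟨-a, by linear_combination -hab⟩
    exact (Nat.card_congr ((Submodule.quotEquivOfEq _ _ hkerπ).symm.trans
      (LinearMap.quotKerEquivOfSurjective π hπ)).toEquiv).symm
  -- Step 6: `M/𝔞M ↠ I/T^m I`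
  have hker' : 𝔞 • (⊤ : Submodule (IwasawaAlgebra p) M) ≤ LinearMap.ker ((I.map θ).mkQ ∘ₗ ψ) := by
    refine Submodule.smul_le.mpr ?_
    intro r hr x _
    rw [LinearMap.mem_ker, LinearMap.comp_apply, Submodule.mkQ_apply, Submodule.Quotient.mk_eq_zero,
      map_smul]
    rw [h𝔞, Ideal.mem_span_pair] at hr
    obtain ⟨a, b, rfl⟩ := hr
    rw [add_smul, mul_smul, mul_smul]
    refine Submodule.add_mem _ ?_ ?_
    · have h0 : (PowerSeries.C (p : ℤ_[p]) : IwasawaAlgebra p) • ψ x = 0 := by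
        obtain ⟨s, hs⟩ := Submodule.mkQ_surjective (augIdealP p) (ψ x)
        rw [← hs, Submodule.mkQ_apply, ← Submodule.Quotient.mk_smul, Submodule.Quotient.mk_eq_zero,
          augIdealP, smul_eq_mul]
        exact Ideal.mul_mem_right _ _ (Ideal.mem_span_singleton_self _)
      rw [h0, smul_zero]; exact Submodule.zero_mem _
    · exact Submodule.smul_mem _ _ ⟨ψ x, ⟨x, rfl⟩, rfl⟩
  have hcard_le : Nat.card (I.map (I.map θ).mkQ) ≤
      Nat.card (M ⧸ 𝔞 • (⊤ : Submodule (IwasawaAlgebra p) M)) := by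
    have hr : LinearMap.range (Submodule.liftQ (𝔞 • ⊤) ((I.map θ).mkQ ∘ₗ ψ) hker') =
        I.map (I.map θ).mkQ := by
      rw [Submodule.range_liftQ, LinearMap.range_comp]
    rw [← hr]
    exact Nat.card_le_card_of_surjective _ (LinearMap.surjective_rangeRestrict _)
  -- Step 7: contradiction with the certificate inequality
  have hge : Nat.card (IwasawaAlgebra p ⧸ 𝔞) ≤ Nat.card (M ⧸ 𝔞 • (⊤ : Submodule (IwasawaAlgebra p) M)) := by
    rw [← hQC, ← hcount]; exact hcard_le
  exact absurd hlt (not_lt.mpr hge)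

/-- **`#(Λ/(p, T^m)) = p^m`**: the coefficient map `r ↦ (r_k mod p)_{k<m}` is a surjection
`Λ = ℤ_p⟦T⟧ → 𝔽_p^m` with kernel `(p, T^m)`. [cite: Washington1997, §7.1 (Λ = ℤ_p⟦T⟧), §13.2] -/
theorem natCard_quotient_span_C_X_pow (m : ℕ) :
    Nat.card (IwasawaAlgebra p ⧸
      Ideal.span {PowerSeries.C (p : ℤ_[p]), (PowerSeries.X : IwasawaAlgebra p) ^ m}) = p ^ m := by
  classical
  haveI : NeZero p := ⟨(Fact.out : p.Prime).ne_zero⟩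
  set 𝔞 : Ideal (IwasawaAlgebra p) :=
    Ideal.span {PowerSeries.C (p : ℤ_[p]), (PowerSeries.X : IwasawaAlgebra p) ^ m} with h𝔞
  let g : IwasawaAlgebra p →ₗ[ℤ] (Fin m → ZMod p) :=
    LinearMap.pi fun k : Fin m =>
      ((PadicInt.toZMod : ℤ_[p] →+* ZMod p).toAddMonoidHom.comp
        (PowerSeries.coeff (k : ℕ) : IwasawaAlgebra p →ₗ[ℤ_[p]] ℤ_[p]).toAddMonoidHom).toIntLinearMap
  have hg_apply : ∀ (r : IwasawaAlgebra p) (k : Fin m),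
      g r k = PadicInt.toZMod (PowerSeries.coeff (k : ℕ) r) := fun r k => rfl
  have hdvd : ∀ r : ℤ_[p], PadicInt.toZMod r = 0 ↔ (p : ℤ_[p]) ∣ r := by
    intro r
    rw [← RingHom.mem_ker, PadicInt.ker_toZMod, PadicInt.maximalIdeal_eq_span_p,
      Ideal.mem_span_singleton]
  have hker : LinearMap.ker g = 𝔞.restrictScalars ℤ := by
    ext r
    simp only [LinearMap.mem_ker, Submodule.restrictScalars_mem, funext_iff, Pi.zero_apply, hg_apply,
      hdvd]
    constructor
    · intro h
      choose c hc using h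
      let a : IwasawaAlgebra p := PowerSeries.mk fun k => if hk : k < m then c ⟨k, hk⟩ else 0
      have hX : (PowerSeries.X : IwasawaAlgebra p) ^ m ∣ r - PowerSeries.C (p : ℤ_[p]) * a := by
        rw [PowerSeries.X_pow_dvd_iff]
        intro k hk
        rw [map_sub, PowerSeries.coeff_C_mul, PowerSeries.coeff_mk, dif_pos hk, hc ⟨k, hk⟩, sub_self]
      obtain ⟨b, hb⟩ := hX
      rw [h𝔞, Ideal.mem_span_pair]
      exact ⟨a, b, by linear_combination -hb⟩
    · intro h k
      rw [h𝔞, Ideal.mem_span_pair] at h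
      obtain ⟨a, b, rfl⟩ := h
      refine ⟨PowerSeries.coeff (k : ℕ) a, ?_⟩
      rw [map_add, PowerSeries.coeff_mul_C, PowerSeries.coeff_mul_X_pow', if_neg (not_le.mpr k.2),
        add_zero, mul_comm]
  have hsurj : Function.Surjective g := by
    intro v
    refine ⟨PowerSeries.mk fun k => if hk : k < m then ((v ⟨k, hk⟩).val : ℤ_[p]) else 0, ?_⟩
    funext k
    rw [hg_apply, PowerSeries.coeff_mk, dif_pos k.2, map_natCast, ZMod.natCast_zmod_val]
  have e : (IwasawaAlgebra p ⧸ 𝔞) ≃ₗ[ℤ] (Fin m → ZMod p) :=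
    (Submodule.Quotient.restrictScalarsEquiv ℤ 𝔞).symm.trans
      ((Submodule.quotEquivOfEq _ _ hker.symm).trans (LinearMap.quotKerEquivOfSurjective g hsurj))
  rw [Nat.card_congr e.toEquiv, Nat.card_fun, Nat.card_zmod, Nat.card_eq_fintype_card, Fintype.card_fin]

/-- `muInvariant_eq_zero_of_natCard_quotient_lt` with the count `#(Λ/(p,T^m)) = p^m` inserted:
`#(M/(p, T^m)M) < p^m ⟹ μ(M) = 0`. [cite: Washington1997, §13.2, Thm. 13.12, Lemma 13.7] -/
theorem muInvariant_eq_zero_of_natCard_quotient_lt_pow {M : Type*} [AddCommGroup M]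
    [Module (IwasawaAlgebra p) M] [Module.Finite (IwasawaAlgebra p) M]
    (hM : Module.IsTorsion (IwasawaAlgebra p) M) (m : ℕ)
    [Finite (M ⧸ (Ideal.span {PowerSeries.C (p : ℤ_[p]), (PowerSeries.X : IwasawaAlgebra p) ^ m} •
      (⊤ : Submodule (IwasawaAlgebra p) M)))]
    (hlt : Nat.card (M ⧸ (Ideal.span {PowerSeries.C (p : ℤ_[p]), (PowerSeries.X : IwasawaAlgebra p) ^ m} •
        (⊤ : Submodule (IwasawaAlgebra p) M))) < p ^ m) :
    muInvariant p M = 0 :=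
  muInvariant_eq_zero_of_natCard_quotient_lt p hM m (by rwa [natCard_quotient_span_C_X_pow])

/-- **The layer dictionary `(p, T^{p^n}) = (p, ω_n)`**, `ω_n = (1+T)^{p^n} - 1`: modulo `p`,
`(1+T)^{p^n} ≡ 1 + T^{p^n}` (Frobenius).  Hence `M/(p, T^{p^n})M = M/(p, ω_n)M = (M/pM)_{Γ_n}` when `γ`
acts as `1 + T` (`Γ_n = Γ^{p^n}`): the certificate quotient at `m = p^n` is the `Γ_n`-coinvariant
quotient of `M/pM`, i.e. for `M = X_p(E/ℚ_∞)` the Pontryagin dual of `(Sel_{p^∞}(E/ℚ_∞)[p])^{Γ_n}`.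
[cite: Washington1997, §13.2 (ω_n = (1+T)^{p^n} − 1, Lemma 13.7ff)] [cite: GreenbergLNM1716, §1] -/
theorem span_C_X_pow_eq_span_C_omega (n : ℕ) :
    Ideal.span {PowerSeries.C (p : ℤ_[p]), (PowerSeries.X : IwasawaAlgebra p) ^ (p ^ n)} =
      Ideal.span {PowerSeries.C (p : ℤ_[p]),
        (1 + PowerSeries.X : IwasawaAlgebra p) ^ (p ^ n) - 1} := by
  have hC : (p : IwasawaAlgebra p) = PowerSeries.C (p : ℤ_[p]) :=
    (map_natCast (PowerSeries.C (R := ℤ_[p])) p).symm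
  have hpnu : (p : IwasawaAlgebra p) ∈ nonunits (IwasawaAlgebra p) := by
    rw [mem_nonunits_iff, PowerSeries.isUnit_iff_constantCoeff, map_natCast]
    exact PadicInt.irreducible_p.not_isUnit
  haveI : CharP (IwasawaAlgebra p ⧸ Ideal.span {(p : IwasawaAlgebra p)}) p :=
    CharP.quotient (IwasawaAlgebra p) p hpnu
  have hmem : (1 + PowerSeries.X : IwasawaAlgebra p) ^ (p ^ n) - 1 - PowerSeries.X ^ (p ^ n) ∈
      Ideal.span {(p : IwasawaAlgebra p)} := by
    rw [← Ideal.Quotient.eq_zero_iff_mem]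
    simp only [map_sub, map_pow, map_add, map_one]
    rw [add_pow_char_pow (1 : IwasawaAlgebra p ⧸ Ideal.span {(p : IwasawaAlgebra p)}) _ p n, one_pow]
    ring
  obtain ⟨c, hc⟩ := Ideal.mem_span_singleton'.mp hmem
  have hω : (1 + PowerSeries.X : IwasawaAlgebra p) ^ (p ^ n) - 1 =
      PowerSeries.X ^ (p ^ n) + c * PowerSeries.C (p : ℤ_[p]) := by
    rw [← hC]; linear_combination -hc
  rw [hω, Ideal.span_pair_add_mul_left]

end MuCriterion

end Summit.BirchSwinnertonDyer.Rank2

end
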